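import Literature.Combinatorics.Optimization.TracialDesigns
import Literature.NumberTheory.Automorphic.ShimuraCurveFiniteVolume
import HarnessLib

/-!
# Cell pnp-psdrank, route `ChebyshevTracialDesign`: TWO-BY-TWO ALGEBRA for the synchronisation argument at `r = 2` — singular parts, rank-one
# labels, complementary projections

Elementary `2 × 2` facts used by the dimension-two synchronisation theorem (brick 61, `…DimTwoSynchronisation`) for the crux `TracialDecayExp20`
(stmt-PneNP-19878), brick 60 (prover g11; MEMO-14 §5 (a)):
* (Cayley–Hamilton `Z² = tr(Z)·Z − det(Z)·I` is REUSED: `Literature.NumberTheory.Automorphic.mul_self_eq_trace_smul_sub_det_smul`);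
* `exists_lowerBound_singular` — a psd `X` has a lower spectral bound `λ ≥ 0` (its smaller eigenvalue, written with a square root) with `X − λI ⪰ 0`
  and `det(X − λI) = 0`: the input of brick 58's scalar peeling that makes every operator SINGULAR;
* `label_proj` — a singular psd `Z ≠ 0` is `tr(Z)·P` with `P = Z/tr(Z)` a symmetric idempotent of trace `1` (its RANK-ONE LABEL);
* `eq_one_sub_of_mul_eq_zero` — two rank-one projections of `ℝ²` with `P Q = 0` are complementary, `Q = 1 − P`: tightness of an active pair of singular
  operators is EQUALITY OF LABELS `P_U = 1 − Q_M` (angle synchronisation);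
* `eq_zero_of_trace_eq_zero`, `trace_pos_of_ne_zero`, `trace_le_two` — trace bookkeeping for psd contractions of `ℝ²`.
[folklore linear algebra; cite: BrietDadushPokutta2014, Thm. 6 (§3) for the role of psd factorizations]
Stature: support/instrument (no defs). WHAT THIS IS NOT: nothing on designs, the dense cell, psd rank or P-vs-NP. Supports stmt-PneNP-19878.
-/

set_option linter.dupNamespace false -- `Summit.PneNP.PneNP.…`: summit = sub-problem (D-0017)

noncomputable section

namespace Summit.PneNP.PneNP.Theorems.ChebyshevTracialDesignDimTwoAlgebra

open Finset Matrix
open Literature.NumberTheory.Automorphic (mul_self_eq_trace_smul_sub_det_smul)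

/-! ### §1 Two-by-two algebra: singular parts, rank-one labels, complementary projections -/

/-- **Singular part of a psd `2 × 2` contraction.** For `X ⪰ 0` there is `λ ≥ 0` (the smaller eigenvalue) with `X − λI ⪰ 0` and
`det(X − λI) = 0`. [folklore] -/
theorem exists_lowerBound_singular {X : Matrix (Fin 2) (Fin 2) ℝ} (hX : X.PosSemidef) :
    ∃ lam : ℝ, 0 ≤ lam ∧ (X - lam • (1 : Matrix (Fin 2) (Fin 2) ℝ)).PosSemidef ∧ (X - lam • (1 : Matrix (Fin 2) (Fin 2) ℝ)).det = 0 := by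
  set a := X 0 0 with ha
  set d := X 1 1 with hd
  set b := X 0 1 with hb
  have hb' : X 1 0 = b := by have h := hX.1.apply 0 1; rw [star_trivial] at h; exact h
  have hs0 : 0 ≤ a + d := by have h := hX.trace_nonneg; rwa [trace_fin_two] at h
  have hdet0 : 0 ≤ a * d - b * b := by have h := hX.det_nonneg; rwa [det_fin_two, hb'] at h
  set q := Real.sqrt ((a - d) ^ 2 + 4 * b ^ 2) with hq
  have hdisc : 0 ≤ (a - d) ^ 2 + 4 * b ^ 2 := by positivity
  have hq0 : 0 ≤ q := Real.sqrt_nonneg _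
  have hq2 : q ^ 2 = (a - d) ^ 2 + 4 * b ^ 2 := Real.sq_sqrt hdisc
  have hqs : q ≤ a + d := by
    rw [hq, ← Real.sqrt_sq hs0]
    exact Real.sqrt_le_sqrt (by nlinarith)
  have hqad : |a - d| ≤ q := by
    rw [hq, ← Real.sqrt_sq_eq_abs]
    exact Real.sqrt_le_sqrt (by nlinarith)
  set lam := (a + d - q) / 2 with hlam
  refine ⟨lam, by rw [hlam]; linarith, ?_, ?_⟩
  · -- `Z := X − λI` is symmetric with `tr Z = q ≥ 0`, `det Z = 0`: `Z = (1/q) Z Zᵀ` (or `Z = 0`)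
    set Z := X - lam • (1 : Matrix (Fin 2) (Fin 2) ℝ) with hZ
    have hZH : Zᴴ = Z := by
      rw [hZ, conjTranspose_sub, hX.1.eq, conjTranspose_smul, conjTranspose_one, star_trivial]
    have hZ00 : Z 0 0 = a - lam := by rw [hZ, ha]; simp
    have hZ11 : Z 1 1 = d - lam := by rw [hZ, hd]; simp
    have hZ01 : Z 0 1 = b := by rw [hZ, hb]; simp
    have hZ10 : Z 1 0 = b := by rw [hZ, ← hb']; simp
    have htrZ : Z.trace = q := by rw [trace_fin_two, hZ00, hZ11, hlam]; ring
    have hdetZ : Z.det = 0 := by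
      rw [det_fin_two, hZ00, hZ11, hZ01, hZ10, hlam]; linear_combination (1 / 4 : ℝ) * hq2
    rcases hq0.eq_or_lt with hq00 | hqpos
    · -- `q = 0`: `a = d`, `b = 0`, `Z = 0`
      have had : a - d = 0 := by
        have : |a - d| ≤ 0 := by rw [hq00]; exact hqad
        exact abs_eq_zero.1 (le_antisymm this (abs_nonneg _))
      have hb0 : b = 0 := by nlinarith [hq2, hq00]
      have e00 : Z 0 0 = 0 := by rw [hZ00, hlam, ← hq00]; linarith
      have e01 : Z 0 1 = 0 := by rw [hZ01, hb0]
      have e10 : Z 1 0 = 0 := by rw [hZ10, hb0]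
      have e11 : Z 1 1 = 0 := by rw [hZ11, hlam, ← hq00]; linarith
      have hZ0 : Z = 0 := by
        ext i j
        fin_cases i <;> fin_cases j
        · exact e00
        · exact e01
        · exact e10
        · exact e11
      rw [hZ0]; exact PosSemidef.zero
    · have hZZ : Z * Zᴴ = q • Z := by rw [hZH, mul_self_eq_trace_smul_sub_det_smul, htrZ, hdetZ, zero_smul, sub_zero]
      have hZeq : Z = (1 / q) • (Z * Zᴴ) := by rw [hZZ, smul_smul, one_div_mul_cancel hqpos.ne', one_smul]
      rw [hZeq]
      exact (posSemidef_self_mul_conjTranspose Z).smul (by positivity)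
  · -- `det(X − λI) = 0`
    have h00 : (X - lam • (1 : Matrix (Fin 2) (Fin 2) ℝ)) 0 0 = a - lam := by rw [ha]; simp
    have h11 : (X - lam • (1 : Matrix (Fin 2) (Fin 2) ℝ)) 1 1 = d - lam := by rw [hd]; simp
    have h01 : (X - lam • (1 : Matrix (Fin 2) (Fin 2) ℝ)) 0 1 = b := by rw [hb]; simp
    have h10 : (X - lam • (1 : Matrix (Fin 2) (Fin 2) ℝ)) 1 0 = b := by rw [← hb']; simp
    rw [det_fin_two, h00, h11, h01, h10, hlam]; linear_combination (1 / 4 : ℝ) * hq2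

/-- **Rank-one label.** For a psd `2 × 2` matrix `Z` with `det Z = 0` and `tr Z > 0`, `P := (tr Z)⁻¹·Z` is a symmetric idempotent of trace `1`
and `Z = tr(Z)·P`. [folklore] -/
theorem label_proj {Z : Matrix (Fin 2) (Fin 2) ℝ} (hZ : Z.PosSemidef) (hdet : Z.det = 0) (htr : 0 < Z.trace) :
    ((Z.trace)⁻¹ • Z) * ((Z.trace)⁻¹ • Z) = (Z.trace)⁻¹ • Z ∧ ((Z.trace)⁻¹ • Z)ᵀ = (Z.trace)⁻¹ • Z ∧
      ((Z.trace)⁻¹ • Z).trace = 1 ∧ Z = Z.trace • ((Z.trace)⁻¹ • Z) := by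
  have hZs : Zᵀ = Z := by
    have h := hZ.1; rwa [IsHermitian, conjTranspose_eq_transpose_of_trivial] at h
  refine ⟨?_, ?_, ?_, ?_⟩
  · rw [smul_mul_smul_comm, mul_self_eq_trace_smul_sub_det_smul, hdet, zero_smul, sub_zero, smul_smul, mul_assoc, inv_mul_cancel₀ htr.ne', mul_one]
  · rw [transpose_smul, hZs]
  · rw [trace_smul, smul_eq_mul, inv_mul_cancel₀ htr.ne']
  · rw [smul_smul, mul_inv_cancel₀ htr.ne', one_smul]

/-- **Two orthogonal rank-one projections of `ℝ²` are complementary**: `P Q = 0` for symmetric idempotents of trace `1` forces `Q = 1 − P`.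
[folklore] -/
theorem eq_one_sub_of_mul_eq_zero {P Q : Matrix (Fin 2) (Fin 2) ℝ} (hPs : Pᵀ = P) (hPi : P * P = P) (hPt : P.trace = 1)
    (hQs : Qᵀ = Q) (hQi : Q * Q = Q) (hQt : Q.trace = 1) (hPQ : P * Q = 0) : Q = 1 - P := by
  have hQP : Q * P = 0 := by
    have h := congrArg transpose hPQ; rwa [transpose_mul, hPs, hQs, transpose_zero] at h
  -- `R := 1 − P − Q` is a symmetric idempotent of trace `0`, hence `0`
  set R : Matrix (Fin 2) (Fin 2) ℝ := 1 - P - Q with hR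
  have hRi : R * R = R := by
    rw [hR]
    simp only [sub_mul, mul_sub, Matrix.one_mul, Matrix.mul_one, hPi, hQi, hPQ, hQP]
    abel
  have hRs : Rᵀ = R := by rw [hR, transpose_sub, transpose_sub, transpose_one, hPs, hQs]
  have hRt : R.trace = 0 := by rw [hR, trace_sub, trace_sub, trace_one, Fintype.card_fin, hPt, hQt]; norm_num
  have h10 : R 1 0 = R 0 1 := by
    have h := congrFun (congrFun hRs 1) 0; rw [transpose_apply] at h; exact h.symm
  have hsq : R 0 0 ^ 2 + 2 * R 0 1 ^ 2 + R 1 1 ^ 2 = 0 := by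
    have h := congrArg Matrix.trace hRi
    rw [hRt, trace_fin_two, Matrix.mul_apply, Matrix.mul_apply, Fin.sum_univ_two, Fin.sum_univ_two, h10] at h
    nlinarith [h]
  have h00 : R 0 0 = 0 := by nlinarith [sq_nonneg (R 0 0), sq_nonneg (R 0 1), sq_nonneg (R 1 1)]
  have h01 : R 0 1 = 0 := by nlinarith [sq_nonneg (R 0 0), sq_nonneg (R 0 1), sq_nonneg (R 1 1)]
  have h11 : R 1 1 = 0 := by nlinarith [sq_nonneg (R 0 0), sq_nonneg (R 0 1), sq_nonneg (R 1 1)]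
  have hR0 : R = 0 := by
    ext i j; fin_cases i <;> fin_cases j
    · exact h00
    · exact h01
    · exact h10.trans h01
    · exact h11
  have : 1 - P - Q = 0 := hR0
  rw [sub_eq_zero] at this
  exact this.symm

/-! ### §2 Psd `2 × 2` matrices: traces -/

/-- A psd `2 × 2` real matrix with zero trace vanishes. [folklore] -/
theorem eq_zero_of_trace_eq_zero {Z : Matrix (Fin 2) (Fin 2) ℝ} (hZ : Z.PosSemidef) (htr : Z.trace = 0) : Z = 0 := by
  have h10 : Z 1 0 = Z 0 1 := by have h := hZ.1.apply 0 1; rw [star_trivial] at h; exact h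
  have h00 : 0 ≤ Z 0 0 := by
    have h := hZ.dotProduct_mulVec_nonneg ![1, 0]
    simpa [dotProduct, mulVec, Fin.sum_univ_two] using h
  have h11 : 0 ≤ Z 1 1 := by
    have h := hZ.dotProduct_mulVec_nonneg ![0, 1]
    simpa [dotProduct, mulVec, Fin.sum_univ_two] using h
  rw [trace_fin_two] at htr
  have hdet := hZ.det_nonneg
  rw [det_fin_two, h10] at hdet
  have e00 : Z 0 0 = 0 := by linarith
  have e11 : Z 1 1 = 0 := by linarith
  have e01 : Z 0 1 = 0 := by nlinarith [sq_nonneg (Z 0 1)]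
  ext i j
  fin_cases i <;> fin_cases j
  · exact e00
  · exact e01
  · exact h10.trans e01
  · exact e11

/-- A nonzero psd `2 × 2` matrix has positive trace; a psd contraction has trace `≤ 2`. [folklore] -/
theorem trace_pos_of_ne_zero {Z : Matrix (Fin 2) (Fin 2) ℝ} (hZ : Z.PosSemidef) (hne : Z ≠ 0) : 0 < Z.trace :=
  lt_of_le_of_ne hZ.trace_nonneg fun h => hne (eq_zero_of_trace_eq_zero hZ h.symm)

/-- A psd contraction of `ℝ²` has trace at most `2`. [folklore] -/
theorem trace_le_two {Z : Matrix (Fin 2) (Fin 2) ℝ} (hZ1 : (1 - Z).PosSemidef) : Z.trace ≤ 2 := by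
  have h := hZ1.trace_nonneg
  rw [trace_sub, trace_one, Fintype.card_fin] at h
  norm_num at h
  linarith

end Summit.PneNP.PneNP.Theorems.ChebyshevTracialDesignDimTwoAlgebra
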